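import Summits.CriticalPhenomena.PercolationContinuityZ3.Theorems.SahiMasterFamilyFCombFace
import Summits.CriticalPhenomena.PercolationContinuityZ3.Theorems.SahiMasterFamilyFCombReadOnce
import Mathlib.Tactic.Linarith
import HarnessLib

/-!
# The master-family `F`-inequality for READ-ONCE third events, every product measure

Support file (cell `prim-bnk`, seat bnk-2 gen 20; `--supports stmt-CriticalPhenomena-4575`; memo
`run/shared/lean/prim/prim-l12/FROM-prim-bnk-2-g20-CP-CERTIFICATES.md`, Theorem 3 + §7(0)).  One definition (`MForm.restrictMap`, restriction
of a monotone formula to a face), no `sorry`, standard axioms.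

**THEOREM (`F_nonneg_readOnce`).**  For every `n`, every read-once monotone formula `φ` in the variables `Fin n` (AND/OR tree, each variable at
most once; `G = φ.eval`), every parameter vector `p ∈ [0,1]^n` (weights `w_p(s) = ∏ i (p i if s i else 1 − p i)`, `μ_p X = Σ_s w_p(s)[X s]`) and all
monotone `A, B : (Fin n → Bool) → Bool`:
`(1 + μ_pG)·μ_p(A∩B∩G) − μ_pG·μ_p(A∩B) − μ_p(A∩G)·μ_p(B∩G) ≥ 0`
— the conjectured inequality `F(A,B;G) ≥ 0` of `prim-master-conj` (POINTWISE §21; the 0-minor core of MD₃, p312646) for ALL read-once third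
events in every dimension: principal filters, ORs of coordinates, caterpillars, every `G` with `≤ 2` minimal elements, and all deeper AND/OR
trees (e.g. `(x₁x₂ ∨ x₃x₄)(x₅ ∨ x₆x₇)`, beyond the `≤ 6`-junta census).  Proof: face expansion (`F_nonneg_of_face_combs_nonneg`) + re-indexing
(`face_comb_sum_eq`) + restriction of read-once formulas to faces is read-once (`readOnce_restrictMap`) + the comb theorem
`comb_sum_nonneg_of_readOnce`.  Boolean-function encoding of events; translation to the tree's `Set (Set κ)`/`bernoulliWeight` vocabulary not
done here.  HONEST FRAMING: read-once `G` only; `F ≥ 0` for general third events remains OPEN (memo: CONJECTURE CP). [this work]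
-/

namespace Summit.CriticalPhenomena.PercolationContinuityZ3.Theorems

namespace SahiFComb

open Finset

variable {n m : ℕ}

namespace MForm

/-- Restriction of a formula to the face with free coordinates `{i : d i}` (re-indexed through `e`) and frozen values `z` elsewhere,
absorbing the constants. -/
def restrictMap (d z : Fin n → Bool) (e : Fin m ≃ {i : Fin n // d i = true}) : MForm n → MForm m
  | var i => if h : d i = true then var (e.symm ⟨i, h⟩) else (if z i then tt else ff)
  | tt => tt
  | ff => ff
  | and f g => mkAnd (restrictMap d z e f) (restrictMap d z e g)
  | or f g => mkOr (restrictMap d z e f) (restrictMap d z e g)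

/-- Evaluating the restriction is evaluating at the face point. [this work] -/
theorem eval_restrictMap (d z : Fin n → Bool) (e : Fin m ≃ {i : Fin n // d i = true}) (φ : MForm n) (y : Fin m → Bool) :
    eval (restrictMap d z e φ) y = eval φ (fun i => if h : d i = true then y (e.symm ⟨i, h⟩) else z i) := by
  induction φ with
  | var i =>
      by_cases h : d i = true
      · simp [restrictMap, eval, h]
      · cases hz : z i <;> simp [restrictMap, eval, h, hz]
  | tt => rfl
  | ff => rfl
  | and f g ihf ihg => simp only [restrictMap, eval_mkAnd, ihf, ihg, eval]
  | or f g ihf ihg => simp only [restrictMap, eval_mkOr, ihf, ihg, eval]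

/-- Variables of the restriction come from variables of the formula. [this work] -/
theorem mem_vars_restrictMap (d z : Fin n → Bool) (e : Fin m ≃ {i : Fin n // d i = true}) (φ : MForm n) :
    ∀ j, j ∈ vars (restrictMap d z e φ) → (e j).1 ∈ vars φ := by
  induction φ with
  | var i =>
      intro j hj
      by_cases h : d i = true
      · simp only [restrictMap, h, dif_pos, vars, Finset.mem_singleton] at hj
        subst hj
        simp [vars]
      · cases hz : z i <;> simp [restrictMap, h, hz, vars] at hj
  | tt => intro j hj; simp [restrictMap, vars] at hj
  | ff => intro j hj; simp [restrictMap, vars] at hj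
  | and f g ihf ihg =>
      intro j hj
      have := vars_mkAnd _ _ hj
      simp only [vars, Finset.mem_union] at this ⊢
      exact this.elim (fun h => Or.inl (ihf j h)) (fun h => Or.inr (ihg j h))
  | or f g ihf ihg =>
      intro j hj
      have := vars_mkOr _ _ hj
      simp only [vars, Finset.mem_union] at this ⊢
      exact this.elim (fun h => Or.inl (ihf j h)) (fun h => Or.inr (ihg j h))

/-- Restriction preserves read-once. [this work] -/
theorem readOnce_restrictMap (d z : Fin n → Bool) (e : Fin m ≃ {i : Fin n // d i = true}) :
    ∀ φ : MForm n, ReadOnce φ → ReadOnce (restrictMap d z e φ) := by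
  have key : ∀ f g : MForm n, Disjoint (vars f) (vars g) →
      Disjoint (vars (restrictMap d z e f)) (vars (restrictMap d z e g)) := by
    intro f g hd
    refine Finset.disjoint_left.mpr (fun j hjf hjg => ?_)
    exact Finset.disjoint_left.mp hd (mem_vars_restrictMap d z e f j hjf) (mem_vars_restrictMap d z e g j hjg)
  intro φ
  induction φ with
  | var i =>
      intro _
      by_cases h : d i = true
      · simp [restrictMap, h, ReadOnce]
      · cases hz : z i <;> simp [restrictMap, h, hz, ReadOnce]
  | tt => intro _; trivial
  | ff => intro _; trivial
  | and f g ihf ihg => intro h; exact readOnce_mkAnd (ihf h.2.1) (ihg h.2.2) (key f g h.1)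
  | or f g ihf ihg => intro h; exact readOnce_mkOr (ihf h.2.1) (ihg h.2.2) (key f g h.1)

end MForm

/-- `F ≥ 0` for a third event that is (propositionally) the evaluation of a read-once formula — opaque-`G` form. [this work] -/
theorem F_nonneg_of_eq_readOnce (φ : MForm n) (hφ : φ.ReadOnce) (p : Fin n → ℝ) (hp0 : ∀ i, 0 ≤ p i) (hp1 : ∀ i, p i ≤ 1)
    (A B G : (Fin n → Bool) → Bool) (hA : Monotone A) (hB : Monotone B) (hG : G = φ.eval) :
    0 ≤ (1 + ∑ s : Fin n → Bool, (∏ i, (if s i then p i else 1 - p i)) * (Bool.toNat (G s) : ℝ))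
        * (∑ s : Fin n → Bool, (∏ i, (if s i then p i else 1 - p i)) * (Bool.toNat (A s && B s && G s) : ℝ))
      - (∑ s : Fin n → Bool, (∏ i, (if s i then p i else 1 - p i)) * (Bool.toNat (G s) : ℝ))
        * (∑ s : Fin n → Bool, (∏ i, (if s i then p i else 1 - p i)) * (Bool.toNat (A s && B s) : ℝ))
      - (∑ s : Fin n → Bool, (∏ i, (if s i then p i else 1 - p i)) * (Bool.toNat (A s && G s) : ℝ))
        * (∑ s : Fin n → Bool, (∏ i, (if s i then p i else 1 - p i)) * (Bool.toNat (B s && G s) : ℝ)) := by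
  refine F_nonneg_of_face_combs_nonneg p hp0 hp1 A B G (fun d z => ?_)
  by_cases hz : ∀ i, d i = true → z i = false
  · obtain ⟨e⟩ : Nonempty (Fin (Fintype.card {i : Fin n // d i = true}) ≃ {i : Fin n // d i = true}) :=
      ⟨(Fintype.equivFin _).symm⟩
    rw [face_comb_sum_eq A B G d z e hz]
    -- the restricted third event is read-once again
    have hG' : (fun y : Fin (Fintype.card {i : Fin n // d i = true}) → Bool =>
          G (fun i => if h : d i = true then y (e.symm ⟨i, h⟩) else z i))
        = (MForm.restrictMap d z e φ).eval := by
      funext y; rw [hG, MForm.eval_restrictMap]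
    have hP : Peelable (Fintype.card {i : Fin n // d i = true})
        (fun y => G (fun i => if h : d i = true then y (e.symm ⟨i, h⟩) else z i)) := by
      rw [hG']; exact peelable_of_readOnce _ (MForm.readOnce_restrictMap d z e φ hφ)
    have hA' : Monotone (fun y : Fin (Fintype.card {i : Fin n // d i = true}) → Bool =>
        A (fun i => if h : d i = true then y (e.symm ⟨i, h⟩) else z i)) :=
      fun y y' hy => hA (emb_mono d z e hy)
    have hB' : Monotone (fun y : Fin (Fintype.card {i : Fin n // d i = true}) → Bool =>
        B (fun i => if h : d i = true then y (e.symm ⟨i, h⟩) else z i)) :=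
      fun y y' hy => hB (emb_mono d z e hy)
    have key := comb_sum_nonneg_of_peelable hP _ _ hA' hB'
    exact_mod_cast key
  · rw [← Finset.sum_filter, fiber_eq_empty d z hz, Finset.sum_empty]

/-- **THEOREM (`F ≥ 0` for read-once third events).**  For every read-once monotone formula `φ` in the variables `Fin n`, every `p ∈ [0,1]^n`
and all monotone `A, B`, with `G = φ.eval`:
`(1 + μ_pG)·μ_p(A∩B∩G) − μ_pG·μ_p(A∩B) − μ_p(A∩G)·μ_p(B∩G) ≥ 0`. [this work] -/
theorem F_nonneg_readOnce (φ : MForm n) (hφ : φ.ReadOnce) (p : Fin n → ℝ) (hp0 : ∀ i, 0 ≤ p i) (hp1 : ∀ i, p i ≤ 1)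
    (A B : (Fin n → Bool) → Bool) (hA : Monotone A) (hB : Monotone B) :
    0 ≤ (1 + ∑ s : Fin n → Bool, (∏ i, (if s i then p i else 1 - p i)) * (Bool.toNat (φ.eval s) : ℝ))
        * (∑ s : Fin n → Bool, (∏ i, (if s i then p i else 1 - p i)) * (Bool.toNat (A s && B s && φ.eval s) : ℝ))
      - (∑ s : Fin n → Bool, (∏ i, (if s i then p i else 1 - p i)) * (Bool.toNat (φ.eval s) : ℝ))
        * (∑ s : Fin n → Bool, (∏ i, (if s i then p i else 1 - p i)) * (Bool.toNat (A s && B s) : ℝ))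
      - (∑ s : Fin n → Bool, (∏ i, (if s i then p i else 1 - p i)) * (Bool.toNat (A s && φ.eval s) : ℝ))
        * (∑ s : Fin n → Bool, (∏ i, (if s i then p i else 1 - p i)) * (Bool.toNat (B s && φ.eval s) : ℝ)) :=
  F_nonneg_of_eq_readOnce φ hφ p hp0 hp1 A B φ.eval hA hB rfl

end SahiFComb

end Summit.CriticalPhenomena.PercolationContinuityZ3.Theorems
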